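import Mathlib
import Summits.MatrixMultiplication.MatrixMultiplication.Theses.FourierTwoFamiliesModP
import Summits.MatrixMultiplication.MatrixMultiplication.Theorems.PrimeTwoFamilies.Negative.Slices
import Summits.MatrixMultiplication.MatrixMultiplication.Theorems.FourierTwoFamiliesModPCyclicReductionTransfer
import Summits.MatrixMultiplication.MatrixMultiplication.Theorems.FourierTwoFamiliesModPPrimeTwoFamiliesStubCapBookkeeping
import Summits.MatrixMultiplication.MatrixMultiplication.Theorems.FourierTwoFamiliesModPPrimeTwoFamiliesStubGadgetsOfCrux
import Summits.MatrixMultiplication.MatrixMultiplication.Theorems.FourierTwoFamiliesModPPrimeTwoFamiliesStubHonestOfSelfConverse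

/-!
# Self-converse gadgets `↔ PrimeTwoFamilies`, assembled through honest sub-families (support file)

Item `stmt-MatrixMultiplication-14308` (`FourierTwoFamiliesModP.PrimeTwoFamilies`, CKSU 2005 Conj. 4.7
with prime cyclic hosts), line `Sketch` (capacity-gadget skeleton), registered stub
`selfConverseGadgets_iff_primeTwoFamilies`, stated verbatim (gadget / SDPP clauses inlined).

A *self-converse gadget* of slice `ε` is a list of `r ≥ m^{1-ε}` direct pairs `(P c, Q c)_{c<r}` in `ℤ/m`
of co-volume `|P c| |Q c| ≥ m^{1-ε}` together with a map `π : Fin r → Fin r` under which every ordered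
pair of distinct letters is strongly separated (cross differences avoid all diagonal differences) either
directly or after `π`.

This file assembles the equivalence with the crux from LANDED lemmas of the crux only, along a route
that avoids the code lift: a self-converse gadget CONTAINS an honest SDPP family in the same `ℤ/m`
(`CapacityLift.stub_honestOfSelfConverse`: the letters through a popular point are pairwise
non-separated, so their `π`-images form an honest family with `n ≥ m^{1/2-ε}` pairs of co-volume
`≥ m^{1-ε}`); an honest family in `ℤ/m` moves into a Bertrand prime `p ≤ 6 m` with all sizes kept
(`Theorems.exists_prime_sdpp_of_addEquiv` with ONE cyclic factor, the transfer step of the route support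
`CyclicReduction`); and the exponent bookkeeping `CapacityLift.stub_capBookkeeping` at word length
`L = 1` picks the number `n` of pairs to keep (`p ≤ n^{2+δ}`, `n^{2-δ} ≤ m^{1-ε}`) for every slice
`0 < δ ≤ 1`; slices `δ > 1` follow by `PrimeTwoFamiliesAt.mono`.  The converse direction is letter
repetition, `CapacityLift.stub_gadgetsOfCrux`.
-/

-- single-conjunct summit: the mandated namespace repeats `MatrixMultiplication` (summit = sub-problem).
set_option linter.dupNamespace false

namespace Summit.MatrixMultiplication.MatrixMultiplication.Theorems.PrimeTwoFamilies.SelfConverseHonest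

open Finset
open Summit.MatrixMultiplication.MatrixMultiplication.Theses
open Summit.MatrixMultiplication.MatrixMultiplication.Theorems
open Summit.MatrixMultiplication.MatrixMultiplication.Theorems.PrimeTwoFamilies.Negative

/-- **Self-converse gadgets `↔ PrimeTwoFamilies`** (registered stub `selfConverseGadgets_iff_primeTwoFamilies`
of crux `stmt-MatrixMultiplication-14308`, assembled through honest sub-families).
(⇒) For a slice `0 < δ ≤ 1` and a threshold `n₀`: fix `ε` and `m₀` by `CapacityLift.stub_capBookkeeping`;
`CapacityLift.stub_honestOfSelfConverse` turns the gadget hypothesis into an honest SDPP family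
`(A i, B i)_{i<N}` in some `ℤ/m`, `m ≥ max m₀ 1`, with `m^{1/2-ε} ≤ N` and co-volumes `≥ m^{1-ε}`;
`exists_prime_sdpp_of_addEquiv` (one factor `ℤ/m`, `AddEquiv.funUnique`) moves it into a prime
`p ≤ 2·3·m` with sizes kept; the bookkeeping at `L = 1` gives `n` with `n₀ ≤ n ≤ N`, `p ≤ n^{2+δ}`,
`n^{2-δ} ≤ m^{1-ε}`, and the first `n` pairs (`Fin.castLE`) are the slice witness; slices `δ > 1` by
`PrimeTwoFamiliesAt.mono` from `δ = 1`.  (⇐) letter repetition, `CapacityLift.stub_gadgetsOfCrux`. -/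
theorem selfConverseGadgets_iff_primeTwoFamilies :
    (∀ ε : ℝ, 0 < ε → ∀ m₀ : ℕ, ∃ m ≥ m₀, ∃ r : ℕ, ∃ P Q : Fin r → Finset (ZMod m),
      ∃ π : Fin r → Fin r,
      (∀ c : Fin r, ∀ x ∈ P c, ∀ x' ∈ P c, ∀ y ∈ Q c, ∀ y' ∈ Q c,
          (x - x') + (y - y') = 0 → x = x' ∧ y = y') ∧
      (∀ σ τ : Fin r, σ ≠ τ →
        (∀ p ∈ P σ, ∀ q ∈ Q τ, ∀ c : Fin r, ∀ p' ∈ P c, ∀ q' ∈ Q c, q - p ≠ q' - p') ∨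
        (∀ p ∈ P (π σ), ∀ q ∈ Q (π τ), ∀ c : Fin r, ∀ p' ∈ P c, ∀ q' ∈ Q c, q - p ≠ q' - p')) ∧
      (m : ℝ) ^ (1 - ε) ≤ (r : ℝ) ∧
      ∀ c : Fin r, (m : ℝ) ^ (1 - ε) ≤ (((P c).card * (Q c).card : ℕ) : ℝ)) ↔
    FourierTwoFamiliesModP.PrimeTwoFamilies := by
  classical
  refine ⟨fun h => ?_, fun hT => CapacityLift.stub_gadgetsOfCrux hT⟩
  -- honest SDPP families inside the gadgets' own hosts `ℤ/m`
  have hH := CapacityLift.stub_honestOfSelfConverse h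
  -- every slice `0 < δ ≤ 1`
  have hAt : ∀ δ : ℝ, 0 < δ → δ ≤ 1 → PrimeTwoFamiliesAt δ := by
    intro δ hδ hδ1 n₀
    obtain ⟨ε, hε, hbook⟩ := CapacityLift.stub_capBookkeeping δ hδ hδ1
    obtain ⟨m₀, hm₀⟩ := hbook n₀
    obtain ⟨m, hm, N, A, B, hW, hX, hN, hcov⟩ := hH ε hε (max m₀ 1)
    have hm₀m : m₀ ≤ m := le_trans (le_max_left _ _) hm
    have hm1 : 1 ≤ m := le_trans (le_max_right _ _) hm
    -- transfer into a prime cyclic host with one cyclic factor (route support CyclicReduction)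
    obtain ⟨p, hp, hpR, A', B', hcard, hW', hX'⟩ :=
      exists_prime_sdpp_of_addEquiv hW hX (m := fun _ : Fin 1 => m) (fun _ => hm1)
        (AddEquiv.funUnique (Fin 1) (ZMod m)).symm
    rw [Fin.prod_const] at hpR
    -- the number of pairs kept (bookkeeping at word length `L = 1`)
    have hN' : ((m : ℝ) ^ ((1 : ℕ) : ℝ)) ^ (1 / 2 - ε) ≤ (N : ℝ) := by
      rw [Nat.cast_one, Real.rpow_one]
      exact hN
    obtain ⟨n, hn₀, hnN, hpn, hnP⟩ := hm₀ m hm₀m 1 le_rfl N hN' p hpR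
    rw [pow_one] at hnP
    refine ⟨n, hn₀, p, hp, A' ∘ Fin.castLE hnN, B' ∘ Fin.castLE hnN, ?_, ?_, hpn, ?_⟩
    · intro i
      exact hW' (Fin.castLE hnN i)
    · intro i j k a ha a' ha' b hb b' hb' h0
      exact Fin.castLE_injective hnN (hX' _ _ _ a ha a' ha' b hb b' hb' h0)
    · intro i
      have hci := hcard (Fin.castLE hnN i)
      simp only [Function.comp_apply]
      rw [hci.1, hci.2]
      exact hnP.trans (hcov _)
  rw [primeTwoFamilies_iff]
  intro δ hδ
  by_cases h1 : δ ≤ 1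
  · exact hAt δ hδ h1
  · exact (hAt 1 one_pos le_rfl).mono (le_of_not_ge h1)

end Summit.MatrixMultiplication.MatrixMultiplication.Theorems.PrimeTwoFamilies.SelfConverseHonest
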